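import Summits.BirchSwinnertonDyer.Rank1Residual.X11b.Three.ClassRecordResidual
import Summits.BirchSwinnertonDyer.Rank1Residual.X11b.Three.CharTorsionClasswide
import HarnessLib

/-!
# Class X11b at `p = 3` (team N8/O2 = cell `b2b-bsdres`, seat x11b3-p3): CLASS RECORD v4.3 — the
# class theorem of record `Three.forall_bsdp_of_classRecord_v41` with the road-(b) / road-(d) binder
# `Three.StepLAt W` REPLACED by the three HALVES (H1 BDP-EXISTS@3, H2 BDP-VALUE@3, H3 MI-W3), the
# control input CTL₀@3 being a THEOREM class-wide (`Three/CharTorsionClasswide.lean`)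

HONEST FRAMING (verbatim, cell `b2b-bsdres`, run/shared/lean/b2b/bsd-rank1-residual/): the goal of
the cell is to DELETE the COMBINATION-SHAPED residual classes for ALL analytic-rank `≤ 1` curves
over `ℚ` — "full BSD formula for every rank `≤ 1` curve in class `C`" assembled STRICTLY from
published theorems — so that the rank-`≤ 1` remainder becomes exactly the CONSTRUCTION-SHAPED
classes, which are TYPED (missing-input Props), NOT attempted; this is not "finishing BSD".
Team N8/O2 (X11b at `3`; RESIDUAL-MAP §I O2 OPEN). Research route; nothing booked; NO label
changes. THEOREMS ONLY (no definition, no named fact, no `sorry`).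

## What this file does

`Three/ClassRecordResidual.lean` §2 (p254011) holds CLASS RECORD v4.1/v4.2 as ONE theorem
`Three.forall_bsdp_of_classRecord_v41 : [20 published facts] → [typed binders by road] → ∀ W,
ClassX11b W 3 → BSDp W 3`, whose road-(b) (split(3) ∧ (ram), 961 TRUE-OPEN classes — EVIDENCE count)
and road-(d) (`¬Ram ∧ Surj`, 1) binders carry THE open input in S0 currency, `Three.StepLAt W`. Its
module docstring announced the substitution "of road (b)'s `StepLAt W` binder by the HALVES H1–H3
(`Three.stepLAt_of_halves₃`, S10) … to be appended when they land". S10 HALVES@3 landed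
(`Three/StepLHalves.lean`, p255290 + p255557) as `exists_isNewformOf ∧ CTL₀ ∧ H1 ∧ H2 ∧ H3 ⟹
Three.StepLAt W`, and CTL₀ (`Three.CharTorsionAt₃ W`) is now a THEOREM at EVERY X11b@3 pair
(`Three.charTorsionAt₃_of_classX11b`, `Three/CharTorsionClasswide.lean`: multr1-p2's
`controlUpperOnTreeAt_datum_of_facts`, from Kolyvagin + Poitou–Tate + the local Euler
characteristic — three facts the record ALREADY carries). Hence:

* §1 **`forall_bsdp_of_classRecord_v43`** — CLASS RECORD v4.3 in kernel form: v4.1 with `hL`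
  (road (b)) and `hL₀` (road (d)) REPLACED by `hHb` / `hHd : … → BDPExistsAt₃ W ∧ BDPValueAt₃ W ∧
  IMCDivAt₃ W` — NO control binder, NO new fact; every other binder byte-identical to v4.1.
* §2 **`forall_missingInputAt_of_classRecord_v43`** — the same record in the currency of the cell's
  typed residual `X11Three.MissingInputAt W` (REFEREE R6.2; the form RESIDUAL-MAP §I O2 rows quote).

WHAT IS LEFT of X11b@3 after v4.3, by named sub-population (binders; TRUE-OPEN counts are EVIDENCE,
rmap-3 / x11b3 CLASS RECORD v4.2, unchanged by this file): road (a) NONSPLIT(3) ∧ (ram) [722]: ONE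
per-pair input `ClassClosure.RegulatorNonvanishingAt W 3` (REG3 certificate rows = EVIDENCE); road (b)
SPLIT(3) ∧ (ram) [961]: H1 = BDP-EXISTS@3 [W2; from print up to the ONE residual
`Three.HsiehFrameResidualAt₃ W` by S18 (a) p258780 + (b), x11b3-lit1 / p7], H2 = BDP-VALUE@3 [Cas18
Thm. 3.2 at `3 ∣ N`, not in print], H3 = MI-W3 [no source at `3`] + the (T2′)₃ binders `hSh` / `hUα` /
`hUγ` off A1; road (d) [1]: the same three halves + `hU₀`; the (T4″)₃ corner [0 TRUE-OPEN]: `hCL` /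
`hCT` / `hCU`. CONDITIONAL on every listed binder; nothing booked; O2 OPEN; X11 ∧ `r = 1` ∧ `p = 3`
stays CONSTRUCTION-SHAPED (R6.2); no label / count / mark moves.

References: [Castella2018] Thm. 2.3 (p. 5), Thm. 3.2 (p. 9), §5 (p. 12) (arXiv:1704.06608);
[GreenbergLNM1716] §3 Lemma 3.3; [MilneADT2006] I 2.8, I 4.10(b); [Kolyvagin1990] Thm. A;
[Skinner2016PacificMC] Thm. A, Thm. C; [SteinWuthrich2013] Thm. 6.1, §4.2; [Disegni2020] Thm. 1;
[MatarNekovar2019] Thm. 0.3; [BarriosEtAl2025] Thm. 5.1; [Wuthrich2014] Prop. 21; [Miller2011LMS]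
Def. 1.1.
-/

noncomputable section

open scoped Classical

open WeierstrassCurve NumberField IsDedekindDomain Field Literature.NumberTheory.EllipticCurves
  Rat.HeightOneSpectrum
  Literature.NumberTheory.DiophantineGeometry
  Literature.NumberTheory.EllipticCurves.GreenbergSelmer
  Literature.NumberTheory.EllipticCurves.ModularForms
  Literature.NumberTheory.EllipticCurves.Rank1Residual
  Literature.NumberTheory.EllipticCurves.Rank1Residual.Typed
  Literature.NumberTheory.EllipticCurves.Wuthrich2014
  Literature.NumberTheory.EllipticCurves.BalakrishnanEtAl2019
  Literature.NumberTheory.EllipticCurves.Skinner2016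
  Literature.NumberTheory.EllipticCurves.SteinWuthrich2013
  Literature.NumberTheory.EllipticCurves.Disegni2020
  Literature.NumberTheory.EllipticCurves.BarriosEtAl2025
  Literature.NumberTheory.QuadraticFields.Quadratic
  Literature.NumberTheory.Automorphic
  Literature.NumberTheory.GaloisRepresentations Literature.NumberTheory.GaloisCohomology
  Summit.BirchSwinnertonDyer.Rank1Residual.X11b.AcSelmer
  Summit.BirchSwinnertonDyer.Rank1Residual.X11b.LocBridge

namespace Summit.BirchSwinnertonDyer.Rank1Residual.X11b.Three

/-! ### §1. CLASS RECORD v4.3 — road (b) / road (d) in HALVES currency, no control binder -/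

/-- **X11b at `p = 3`, WHOLE CLASS — CLASS RECORD v4.3 IN KERNEL FORM.** `Three.forall_bsdp_of_classRecord_v41`
(p254011) with the road-(b) binder `hL : … → Three.StepLAt W` and the road-(d) binder `hL₀` REPLACED
by the three HALVES of S10 (`Three/StepLHalves.lean`) — `hHb` / `hHd : … → BDPExistsAt₃ W ∧
BDPValueAt₃ W ∧ IMCDivAt₃ W` (H1 = BDP-EXISTS@3 [W2], H2 = BDP-VALUE@3, H3 = MI-W3; TYPED,
construction-shaped, no source at `3`) — through `Three.stepLAt_of_halves₃_of_classX11b`, whose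
control input CTL₀@3 is a THEOREM at every X11b@3 pair from Kolyvagin + Poitou–Tate + the local Euler
characteristic (`hKo`, `hPT`, `hEP`, already among the twenty published binders). Binder list
otherwise byte-identical to v4.1: PUBLISHED (20); road (a) NONSPLIT(3) ∧ (ram): `hReg`; road (b)
SPLIT(3) ∧ (ram): `hHb`, `hSh` (displays on pure-(T2β)₃), `hUα`, `hUγ`; road (d) `¬Ram ∧ Surj`:
`hHd`, `hU₀`; the (T4″)₃ corner: `hCL`, `hCT`, `hCU` (x11b3-p8's typed inputs). CONDITIONAL on every
listed binder; nothing booked; labels UNCHANGED (X11 ∧ `r = 1` ∧ `p = 3` CONSTRUCTION-SHAPED, R6.2;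
O2 OPEN). [cite: Castella2018, Thm. 2.3 (p. 5), Thm. 3.2 (p. 9), §5 (p. 12) (arXiv:1704.06608; assembly shape, inputs typed)]
[cite: GreenbergLNM1716, §3 Lemma 3.3 (p. 87)] [cite: MilneADT2006, Ch. I, Thm. 4.10(b) and Thm. 2.8]
[cite: Skinner2016PacificMC, Thm. A and Thm. C (§1)] [cite: SteinWuthrich2013, Thm. 6.1, §4.2]
[cite: Disegni2020, Thm. 1 (§1.2)] [cite: MatarNekovar2019, Thm. 0.3 (p. 456)]
[cite: BarriosEtAl2025, Thm. 5.1 (rows R = I₀)] [cite: Wuthrich2014, Prop. 21 (p. 400)] [cite: Miller2011LMS, Def. 1.1] -/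
theorem forall_bsdp_of_classRecord_v43 [Fact (Nat.Prime 3)]
    -- PUBLISHED: the twelve named facts of route p2
    (hGZ : ∀ (N : ℕ) [NeZero N] (W : WeierstrassCurve ℚ) (K : Type) [Field K] [NumberField K],
      gross_zagier N W K)
    (hKo : ∀ (N : ℕ) [NeZero N] (W : WeierstrassCurve ℚ) (K : Type) [Field K] [NumberField K],
      kolyvagin N W K)
    (hB : ∀ (N : ℕ) [NeZero N] (W : WeierstrassCurve ℚ) (K : Type) [Field K] [NumberField K],
      Kolyvagin1990_padicValNat_card_sha_le N W K)
    (hSk : Skinner2016.thmC_padicValRat_bsd_rank_zero) (hWu : sha_dvd_analyticSha)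
    (hGZK : rank_eq_analyticRank_of_analyticRank_le_one) (hmod : hasEntireLFunction_rat)
    (hnf : exists_isNewformOf) (hHL : HoffsteinLuo1997_exists_twist_L_one_ne_zero)
    (hMaz : mazur_not_dvd_maninConstant_of_odd)
    (hPT : ∀ (K : Type) [Field K] [NumberField K], poitouTate_sum_localTatePairing_eq_zero K)
    (hEP : ∀ (K : Type) [Field K] [NumberField K] (v : HeightOneSpectrum (𝓞 K)),
      localEulerPoincareCharacteristic (v.adicCompletion K))
    -- PUBLISHED: Friedberg–Hoffstein, Barrios et al. 2025 (binder at `2`), road (a)'s five,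
    -- Matar–Nekovář 2019 Thm. 0.3 (the corner's `K`-bound)
    (hFH : friedbergHoffstein_exists_twist_ne_zero_inertAt)
    (hBR : localTamagawaNumber_quadraticTwist_two_mem_of_goodReduction)
    (hSkA : thmA_charIdeal_multiplicative) (hJn : thm61_nonsplitMultiplicative)
    (hHn : exists_isMultCanonical) (hD : thm1_padicBSD_rankOne_multiplicative)
    (hpar : nonempty_modularParametrizationData)
    (hMN : ∀ (N : ℕ) [NeZero N] (W : WeierstrassCurve ℚ) (K : Type) [Field K] [NumberField K],
      MatarNekovar2019.thm03_padicValNat_card_sha_le_of_irreducible N W K)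
    -- ROAD (a) NONSPLIT(3) ∧ (ram): ONE per-pair input
    (hReg : ∀ (W : WeierstrassCurve ℚ) [W.IsElliptic] [W.IsGloballyMinimal],
      ClassX11b W 3 → Ram W 3 → ¬ W.HasSplitMultiplicativeReductionAtPrime 3 →
        ClassClosure.RegulatorNonvanishingAt W 3)
    -- ROAD (b) SPLIT(3) ∧ (ram): the three HALVES (no control binder), displays on pure-β, α / γ∖α
    (hHb : ∀ (W : WeierstrassCurve ℚ) [W.IsElliptic] [W.IsGloballyMinimal],
      ClassX11b W 3 → Ram W 3 → W.HasSplitMultiplicativeReductionAtPrime 3 →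
        BDPExistsAt₃ W ∧ BDPValueAt₃ W ∧ IMCDivAt₃ W)
    (hSh : ∀ (W : WeierstrassCurve ℚ) [W.IsElliptic] [W.IsGloballyMinimal],
      ClassX11b W 3 → Ram W 3 → W.HasSplitMultiplicativeReductionAtPrime 3 → ¬ ShapeAlpha W →
        ¬ ShapeGamma W → 3 ∣ W.tamagawaProduct → P2ShimuraDisplaysAt W 3)
    (hUα : ∀ (W : WeierstrassCurve ℚ) [W.IsElliptic] [W.IsGloballyMinimal],
      ClassX11b W 3 → Ram W 3 → ShapeAlpha W → Typed.MissingUpperBoundAt W 3)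
    (hUγ : ∀ (W : WeierstrassCurve ℚ) [W.IsElliptic] [W.IsGloballyMinimal],
      ClassX11b W 3 → Ram W 3 → W.HasSplitMultiplicativeReductionAtPrime 3 → ¬ ShapeAlpha W →
        ShapeGamma W → Typed.MissingUpperBoundAt W 3)
    -- ROAD (d) `¬Ram ∧ Surj`: the three HALVES (no control binder) + the upper half
    (hHd : ∀ (W : WeierstrassCurve ℚ) [W.IsElliptic] [W.IsGloballyMinimal],
      ClassX11b W 3 → ¬ Ram W 3 → Surj W 3 → BDPExistsAt₃ W ∧ BDPValueAt₃ W ∧ IMCDivAt₃ W)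
    (hU₀ : ∀ (W : WeierstrassCurve ℚ) [W.IsElliptic] [W.IsGloballyMinimal],
      ClassX11b W 3 → Surj W 3 → ¬ Ram W 3 → Typed.MissingUpperBoundAt W 3)
    -- THE (T4″)@3 CORNER `¬Surj` (x11b3-p8's typed inputs, `CornerResidual.lean`, p253638)
    (hCL : ∀ (W : WeierstrassCurve ℚ) [W.IsElliptic] [W.IsGloballyMinimal], CornerStepLAt W)
    (hCT : ∀ (W : WeierstrassCurve ℚ) [W.IsElliptic] [W.IsGloballyMinimal], CornerTwistAt W)
    (hCU : ∀ (W : WeierstrassCurve ℚ) [W.IsElliptic] [W.IsGloballyMinimal], CornerUpperAt W)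
    (W : WeierstrassCurve ℚ) [W.IsElliptic] [W.IsGloballyMinimal] (hX : ClassX11b W 3) :
    BSDp W 3 :=
  forall_bsdp_of_classRecord_v41 hGZ hKo hB hSk hWu hGZK hmod hnf hHL hMaz hPT hEP hFH hBR hSkA hJn
    hHn hD hpar hMN hReg
    (fun W _ _ hX hram hsplit ↦
      stepLAt_of_halves₃_of_classX11b hnf hKo hPT hEP hX (hHb W hX hram hsplit).1
        (hHb W hX hram hsplit).2.1 (hHb W hX hram hsplit).2.2)
    hSh hUα hUγ
    (fun W _ _ hX hnram hsurj ↦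
      stepLAt_of_halves₃_of_classX11b hnf hKo hPT hEP hX (hHd W hX hnram hsurj).1
        (hHd W hX hnram hsurj).2.1 (hHd W hX hnram hsurj).2.2)
    hU₀ hCL hCT hCU W hX

/-! ### §2. CLASS RECORD v4.3 in the currency of the cell's typed residual -/

/-- **CLASS RECORD v4.3 ⟹ the CLASS's typed missing input at every X11b@3 pair.** Under exactly the
binders of `forall_bsdp_of_classRecord_v43` (20 published facts; road (a)'s per-pair
`RegulatorNonvanishingAt W 3`; road (b)'s / road (d)'s three HALVES + (T2′)₃ binders; the corner's
three typed inputs), the typed residual of RESIDUAL-MAP §I O2 / REFEREE R6.2, `X11Three.MissingInputAt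
W`, holds at every pair of the class (`X11Three.missingInputAt_of_bsdp`: `Ш` finite by GZK, `L'(E,1)
≠ 0` by modularity). CONDITIONAL; nothing booked; O2 OPEN; no label change.
[cite: Miller2011LMS, §1 and Def. 1.1] [cite: Castella2018, Thm. 2.3 (p. 5), Thm. 3.2 (p. 9), §5 (p. 12)]
[cite: Skinner2016PacificMC, Thm. A and Thm. C (§1)] [cite: Disegni2020, Thm. 1 (§1.2)]
[cite: MatarNekovar2019, Thm. 0.3 (p. 456)] [cite: BarriosEtAl2025, Thm. 5.1 (rows R = I₀)] -/
theorem forall_missingInputAt_of_classRecord_v43 [Fact (Nat.Prime 3)]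
    (hGZ : ∀ (N : ℕ) [NeZero N] (W : WeierstrassCurve ℚ) (K : Type) [Field K] [NumberField K],
      gross_zagier N W K)
    (hKo : ∀ (N : ℕ) [NeZero N] (W : WeierstrassCurve ℚ) (K : Type) [Field K] [NumberField K],
      kolyvagin N W K)
    (hB : ∀ (N : ℕ) [NeZero N] (W : WeierstrassCurve ℚ) (K : Type) [Field K] [NumberField K],
      Kolyvagin1990_padicValNat_card_sha_le N W K)
    (hSk : Skinner2016.thmC_padicValRat_bsd_rank_zero) (hWu : sha_dvd_analyticSha)
    (hGZK : rank_eq_analyticRank_of_analyticRank_le_one) (hmod : hasEntireLFunction_rat)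
    (hnf : exists_isNewformOf) (hHL : HoffsteinLuo1997_exists_twist_L_one_ne_zero)
    (hMaz : mazur_not_dvd_maninConstant_of_odd)
    (hPT : ∀ (K : Type) [Field K] [NumberField K], poitouTate_sum_localTatePairing_eq_zero K)
    (hEP : ∀ (K : Type) [Field K] [NumberField K] (v : HeightOneSpectrum (𝓞 K)),
      localEulerPoincareCharacteristic (v.adicCompletion K))
    (hFH : friedbergHoffstein_exists_twist_ne_zero_inertAt)
    (hBR : localTamagawaNumber_quadraticTwist_two_mem_of_goodReduction)
    (hSkA : thmA_charIdeal_multiplicative) (hJn : thm61_nonsplitMultiplicative)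
    (hHn : exists_isMultCanonical) (hD : thm1_padicBSD_rankOne_multiplicative)
    (hpar : nonempty_modularParametrizationData)
    (hMN : ∀ (N : ℕ) [NeZero N] (W : WeierstrassCurve ℚ) (K : Type) [Field K] [NumberField K],
      MatarNekovar2019.thm03_padicValNat_card_sha_le_of_irreducible N W K)
    (hReg : ∀ (W : WeierstrassCurve ℚ) [W.IsElliptic] [W.IsGloballyMinimal],
      ClassX11b W 3 → Ram W 3 → ¬ W.HasSplitMultiplicativeReductionAtPrime 3 →
        ClassClosure.RegulatorNonvanishingAt W 3)
    (hHb : ∀ (W : WeierstrassCurve ℚ) [W.IsElliptic] [W.IsGloballyMinimal],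
      ClassX11b W 3 → Ram W 3 → W.HasSplitMultiplicativeReductionAtPrime 3 →
        BDPExistsAt₃ W ∧ BDPValueAt₃ W ∧ IMCDivAt₃ W)
    (hSh : ∀ (W : WeierstrassCurve ℚ) [W.IsElliptic] [W.IsGloballyMinimal],
      ClassX11b W 3 → Ram W 3 → W.HasSplitMultiplicativeReductionAtPrime 3 → ¬ ShapeAlpha W →
        ¬ ShapeGamma W → 3 ∣ W.tamagawaProduct → P2ShimuraDisplaysAt W 3)
    (hUα : ∀ (W : WeierstrassCurve ℚ) [W.IsElliptic] [W.IsGloballyMinimal],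
      ClassX11b W 3 → Ram W 3 → ShapeAlpha W → Typed.MissingUpperBoundAt W 3)
    (hUγ : ∀ (W : WeierstrassCurve ℚ) [W.IsElliptic] [W.IsGloballyMinimal],
      ClassX11b W 3 → Ram W 3 → W.HasSplitMultiplicativeReductionAtPrime 3 → ¬ ShapeAlpha W →
        ShapeGamma W → Typed.MissingUpperBoundAt W 3)
    (hHd : ∀ (W : WeierstrassCurve ℚ) [W.IsElliptic] [W.IsGloballyMinimal],
      ClassX11b W 3 → ¬ Ram W 3 → Surj W 3 → BDPExistsAt₃ W ∧ BDPValueAt₃ W ∧ IMCDivAt₃ W)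
    (hU₀ : ∀ (W : WeierstrassCurve ℚ) [W.IsElliptic] [W.IsGloballyMinimal],
      ClassX11b W 3 → Surj W 3 → ¬ Ram W 3 → Typed.MissingUpperBoundAt W 3)
    (hCL : ∀ (W : WeierstrassCurve ℚ) [W.IsElliptic] [W.IsGloballyMinimal], CornerStepLAt W)
    (hCT : ∀ (W : WeierstrassCurve ℚ) [W.IsElliptic] [W.IsGloballyMinimal], CornerTwistAt W)
    (hCU : ∀ (W : WeierstrassCurve ℚ) [W.IsElliptic] [W.IsGloballyMinimal], CornerUpperAt W)
    (W : WeierstrassCurve ℚ) [W.IsElliptic] [W.IsGloballyMinimal] (hX : ClassX11b W 3) :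
    X11Three.MissingInputAt W :=
  X11Three.missingInputAt_of_bsdp hmod hGZK W (le_of_eq hX.1)
    (forall_bsdp_of_classRecord_v43 hGZ hKo hB hSk hWu hGZK hmod hnf hHL hMaz hPT hEP hFH hBR hSkA hJn
      hHn hD hpar hMN hReg hHb hSh hUα hUγ hHd hU₀ hCL hCT hCU W hX)

end Summit.BirchSwinnertonDyer.Rank1Residual.X11b.Three

end
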